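import Summits.CriticalPhenomena.Ising3DConformalLimit.Theses.LogPolarProxy
import Summits.CriticalPhenomena.Ising3DConformalLimit.Theorems.PrecisionLaplacianMoebiusLimitOfTwoPointLawInversionBegetsRotations
import HarnessLib

/-!
# Item stmt-CriticalPhenomena-4584 `LogPolarProxy.MoebiusFromTranslationsAndInversion` — proved

Route `LogPolarProxy` (sub-problem `CriticalPhenomena/Ising3DConformalLimit`), support item #9 (the "group lemma"
of card inversion-first-moebius-from-translations): for `Δ > 0` and a normalised, continuous-off-the-diagonals
`S : CorrFamily 3`, `IsTranslationInvariant S → IsScaleCovariant Δ S → IsInversionCovariant Δ S →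
IsMoebiusCovariant Δ S`. By definition `IsMoebiusCovariant Δ S = (IsTranslationInvariant S ∧ IsRotationInvariant S)
∧ IsScaleCovariant Δ S ∧ IsInversionCovariant Δ S`, so only `O(3)`-invariance is missing, and that is EXACTLY the
landed item stmt-CriticalPhenomena-4675 `PositivityBegetsConformality.InversionBegetsRotations`
(`PrecisionLaplacianMoebiusLimitOfTwoPointLaw.stub_inversionBegetsRotations`, p86170: translations + the unit
inversion generate every hyperplane reflection off two poles, Cartan–Dieudonné). The hypotheses `0 < Δ`,
normalisation, continuity and scale covariance are not needed for the rotations (scale covariance is itself a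
consequence of the other two, `inversionBegetsDilations`, p127660). Recorded by the lead of line `Sketch` of the
crux `ExistsContinuousLimit` (stmt-4582), whose composition uses the same group lemma. [folklore]
-/

namespace Summit.CriticalPhenomena.Ising3DConformalLimit.LogPolarProxyMoebiusFromTranslationsAndInversion

open Literature.Probability.LatticeModels
open Summit.CriticalPhenomena.Ising3DConformalLimit.PrecisionLaplacianMoebiusLimitOfTwoPointLaw
  (stub_inversionBegetsRotations)

/-- **Item stmt-CriticalPhenomena-4584: translations, dilations and the unit inversion give full Möbius covariance**
(the rotations come from translations + inversion alone, item 4675). [folklore] -/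
theorem moebiusFromTranslationsAndInversion_proof :
    Summit.CriticalPhenomena.Ising3DConformalLimit.Theses.LogPolarProxy.MoebiusFromTranslationsAndInversion := by
  intro Δ S _hΔ _hN _hcont htr hsc hinv
  exact ⟨⟨htr, stub_inversionBegetsRotations Δ S htr hinv⟩, hsc, hinv⟩

end Summit.CriticalPhenomena.Ising3DConformalLimit.LogPolarProxyMoebiusFromTranslationsAndInversion
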